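import Summits.HubbardSuperconductivity.HubbardSuperconductivity.Theorems.BalabanIRBirGroundStateAverageLROBounds
import Literature.MathematicalPhysics.QuantumLattice.FinDimSpectrumSectorGibbsLimit

/-!
# Route `BalabanIR`, crux `BirGroundStateAverageLRO` (item `stmt-HubbardSuperconductivity-2079`), line `Sketch` (softmin-pair-penalty): stub `stub_logTraceSectorProjLe`

The entropy budget of the softmin lever: for the orthogonal projection `P_S` onto the joint
sector `S = szSector N M` of the Fock space of the two-dimensional fermionic torus of side `L`,

  `log (Re tr P_S) ≤ L² · log 4`.

Proof (folklore finite-dimensional linear algebra): `tr P_S = dim S`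
(`trace_projMatrix_map_eq_finrank`, the transport `Fock.toEuclidean` being the `WithLp` identity,
`map_toEuclidean_eq`), and `dim S ≤ dim Fock = |Finset (Orb Λ_L)| = 2 ^ |Orb Λ_L| = 2 ^ (2L²) = 4 ^ (L²)`
(`Submodule.finrank_le`, `Module.finrank_fintype_fun_eq_card`, `Fintype.card_finset`, `card_orb`;
the same count as `Theorems.finrank_szSector_fermionTorus_le` of the `BirEveryGroundState` thermal
chord, whose module is not imported here to keep the line's closure light); then `log` is monotone
on the positive reals (and `log 0 = 0 ≤ L² log 4` covers `S = ⊥`). Used in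
`everyGroundState_of_floorAt` of the line skeleton
`Cruxes/BirGroundStateAverageLRO/Lines/Sketch.lean`: the sector ground states pay the entropy
price `log (dim S) / β ≤ L² log 4 / (θ L²) = log 4 / θ` at inverse temperature `β = θ L²`.

Source: H. Tasaki, *Physics and Mathematics of Quantum Many-Body Systems* (2020), App. A.2
(projections, `tr P = dim`) and §9.2 (the `4^{|Λ|}`-dimensional Hubbard Fock space). Folklore; no
definition is introduced.
-/

noncomputable section

namespace Summit.HubbardSuperconductivity.HubbardSuperconductivity.Theorems.BirGroundStateAverageLRO.Softmin

open Matrix Finset Literature.MathematicalPhysics.QuantumLattice Literature.Probability.LatticeModels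
open scoped ComplexOrder

/-- `Re tr P_S = dim S` for the projection onto (the Euclidean transport of) the joint sector
`S = szSector N M` of the torus of side `L` (`trace_projMatrix_map_eq_finrank` along
`map_toEuclidean_eq`). Tasaki (2020) App. A.2. [folklore] -/
theorem re_trace_sectorProj_eq_finrank (L N : ℕ) (M : ℝ) :
    (projMatrix ((szSector (Λ := FermionTorus 2 L) N M).map
        (Fock.toEuclidean (ι := Orb (FermionTorus 2 L)) :
          Fock (Orb (FermionTorus 2 L)) →ₗ[ℂ]
            EuclideanSpace ℂ (Finset (Orb (FermionTorus 2 L)))))).trace.re =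
      (Module.finrank ℂ (szSector (Λ := FermionTorus 2 L) N M) : ℝ) := by
  rw [map_toEuclidean_eq, trace_projMatrix_map_eq_finrank, Complex.natCast_re]

/-- **The entropy budget `log (Re tr P_S) ≤ L² log 4`** (stub `stub_logTraceSectorProjLe` of line
`Sketch`): the orthogonal projection `P_S` onto the joint sector `S = szSector N M` of the Hubbard
torus of side `L` has `Re tr P_S = dim S` (`re_trace_sectorProj_eq_finrank`) and
`dim S ≤ dim Fock = 2 ^ (2L²) = 4 ^ (L²)` (`Submodule.finrank_le`, `Fintype.card_finset`,
`card_orb`), and `log` is monotone on `(0, ∞)` (`log 0 = 0 ≤ L² log 4` if `S = ⊥`).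
Tasaki (2020) App. A.2, §9.2. [folklore] -/
theorem stub_logTraceSectorProjLe (L : ℕ) [NeZero L] (N : ℕ) (M : ℝ) :
    Real.log ((projMatrix ((szSector (Λ := FermionTorus 2 L) N M).map
        (Fock.toEuclidean (ι := Orb (FermionTorus 2 L)) :
          Fock (Orb (FermionTorus 2 L)) →ₗ[ℂ]
            EuclideanSpace ℂ (Finset (Orb (FermionTorus 2 L)))))).trace.re) ≤
      (L : ℝ) ^ 2 * Real.log 4 := by
  rw [re_trace_sectorProj_eq_finrank]
  -- `dim S ≤ dim Fock = 2 ^ |Orb Λ_L| = 2 ^ (2L²) = 4 ^ (L²)`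
  have h4n : Module.finrank ℂ (szSector (Λ := FermionTorus 2 L) N M) ≤ 4 ^ (L ^ 2) := by
    refine (Submodule.finrank_le _).trans (le_of_eq ?_)
    have hΛ : Fintype.card (FermionTorus 2 L) = L ^ 2 := by simp
    rw [Module.finrank_fintype_fun_eq_card, Fintype.card_finset, card_orb, hΛ, pow_mul]
    norm_num
  have h4 : (Module.finrank ℂ (szSector (Λ := FermionTorus 2 L) N M) : ℝ) ≤ (4 : ℝ) ^ (L ^ 2) := by
    exact_mod_cast h4n
  have hlog4 : Real.log ((4 : ℝ) ^ (L ^ 2)) = (L : ℝ) ^ 2 * Real.log 4 := by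
    rw [Real.log_pow]
    push_cast
    ring
  rcases Nat.eq_zero_or_pos (Module.finrank ℂ (szSector (Λ := FermionTorus 2 L) N M)) with h0 | hpos
  · -- `S = ⊥`: `log 0 = 0 ≤ L² log 4`
    rw [h0, Nat.cast_zero, Real.log_zero]
    exact mul_nonneg (by positivity) (Real.log_nonneg (by norm_num))
  · rw [← hlog4]
    exact Real.log_le_log (by exact_mod_cast hpos) h4

end Summit.HubbardSuperconductivity.HubbardSuperconductivity.Theorems.BirGroundStateAverageLRO.Softmin
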